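import Summits.ABC.IUTFork.Repair.RHLinearReachLawGenuine
import HarnessLib

/-!
# D-0079 RESCUE sub-cell R-H, row 20 `linear-reach-law` — `RHLinearReachLawExact` (3/3, ROUND-2 INPUT): the EXACT reach cell of the author's line at the
# pilot datum, `RH.LinearReachLaw.CellReachAt` / `HStarReach`, with its certified-integer and column deciders

[R-H candidate — a HYPOTHESIS, claim-tagged `def … : Prop`; never a Literature fact; typed ≠ proved; instantiated ≠ endorsed.] Seat abc-iut-rh-typ-7 gen 2
(pair 7 → row 20; tester abc-iut-rh-tst-7; lead abc-iut-rh-lead g0). TAKES NO SIDE on [IUTchIII] Cor. 3.12 or on any author; nothing here asserts abc proved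
or refuted. Files 1/3 `Repair/RHLinearReachLaw.lean` (p463810: the author's vocabulary, the two lattice integers certified) and 2/3
`Repair/RHLinearReachLawGenuine.lean` (p464190: H⋆₂₀ = `HStar X`, the LINEAR ENVELOPE cell `CellAt`).

WHY. Row 20's round-1 word is «KILL(k1) pooled + WINDOW-LOCATOR(HEX slice)» (`plan/rescue/R-H/ROUND1.tsv` FINAL 19:30Z); its KEEP-on-slice upgrade waits on
ONE door lemma «`HReachCell` ⟹ movers ⟹ `qRegion ⊆ thetaHull`» (abc-iut-rh-tst-7 19:15:56Z (iii); desk abc-iut-rp-d3, mover p461981;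
`Thm311.Real.qRegion_subset_thetaHull_settingPrVolSharp_of_movers`). That door consumes the author's EXACT companion cell `ReachCell e c B j m` —
`∃ k, j²·m ≤ e·k + (j+1)·(c+e−1) ∧ e·k + (j+1)·B ≤ m` — not the linear envelope `LinearLaw`; the two DIFFER on the table (tst-7 (ii); this seat's
reach_variant.py: exact ⊇ envelope, strictly on 50 groups of I06STAR-COLUMNS 1b1f7baf19740121, e.g. HEX:8:5@p7.j2.ev3 below; exact ⊇ row 15's slot cell
at one-place packets; exact = the tame licence cell on tame rows, where the envelope is stronger by `1 + ((j²m−1) mod e)`). This file types the exact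
cell at the pilot datum with the SAME binders as `CellAt` (norm uniformizer `ϖ`, inner conductor `c`, outer order `B` of `log_p(𝒪_{K_x}^×)`), so that the
round-2 slice object exists in the tree the moment the door is funded.

WHAT IS PROVED: `reachCell2l_iff` (`ord_x(q) = 2l·m` ⇒ `ReachCell2l ⟺ ReachCell`); `reachCell2l_of_linearLaw2l` (envelope ⟹ exact, NO divisibility
assumption: content `k = ⌈X/(2le)⌉`); `reachCell2l_mono_cert`; `cellReachAt_of_cellAt` / `hStarReach_of_hStar` (H⋆₂₀ ⟹ exact); `cellReachAt_iff_of_certs`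
(certified integers ⇒ the cell IS the integer cell); `cellReachAt_iff_forall_hReachCell` (FAITHFULNESS to the author's `HReachCell p K_x ϖ (i+1) m`);
`not_cellReachAt_of_not_col` (column-NEG at `(r_in_ub, r_out_sharp)` ⇒ NEG at every field of the type, ties included); `cellReachAt_iff_col_of_not_dvd`
(`(p−1) ∤ e_x`: the column cell DECIDES the exact cell); `reach_not_law_witnesses` (the two kinds of cells where exact ≠ envelope).
Seat-side k1 of the exact cell (`HOME/staging/RH/abc-iut-rh-typ-7/K1-linear-reach-law.md`, reach_variant.py): v1 scope lamSeven 96/256 (= envelope), HEX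
strip 194/272 = 71.3 % (envelope 179), concrete 3/4, pooled 293/532 = 55.1 %; current table 71.6 %; POS ∩ R-W-refuted = 0; HEX-strip slices k₀ (types
ev1,2,3,5,6,10,15,30): l5: 3,6,8,8,9,9,9,9 · l7: 3,5,5,6,6,8,9,9 · l11: 3,4,5,6,6,7,7,8 · l13: 4,4,5,6,6,6,7,8 — still < 95 % pooled (A6 ceiling): a slice
object, not a rescue. [cite: Mochizuki2012, IUTchI Ex. 3.2 (iv) p. 71; IUTchIII Thm. 3.11 (i) (Ind2) p. 154] [cite: NeukirchANT1999, Ch. II (5.5)]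
[claim: Mochizuki2012, status: disputed] for every IUT sentence quoted. 0 sorry; standard axioms.
-/

noncomputable section

open Set Metric Function NumberField IsDedekindDomain
open scoped Pointwise

namespace Summit.ABC.IUTFork.Repair.RH.LinearReachLaw

open Metric Set Literature.IUT.LogVolume Literature.NumberTheory.GaloisRepresentations.Ultrametric

/-! ## §T6.1 The `2l`-cleared exact cell and its arithmetic -/

/-- **The `2l`-cleared exact reach cell** in the datum's own integers (`ord_x(q) = 2l·m_w`): `∃ k, j²·ord_x(q) ≤ 2l·(e·k + (j+1)·(c+e−1)) ∧
2l·(e·k + (j+1)·B) ≤ ord_x(q)`. At `ord_x(q) = 2l·m` it is the author's `ReachCell e c B j m` (`reachCell2l_iff`). Candidate vocabulary, asserts nothing.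
[claim: Mochizuki2012, status: disputed] -/
def ReachCell2l (e c B : ℤ) (j : ℕ) (ordq : ℤ) (l : ℕ) : Prop :=
  ∃ k : ℤ, (j : ℤ) ^ 2 * ordq ≤ 2 * l * (e * k + ((j : ℤ) + 1) * (c + e - 1)) ∧ 2 * l * (e * k + ((j : ℤ) + 1) * B) ≤ ordq

/-- `ord_x(q) = 2l·m` ⇒ (`ReachCell2l ⟺ ReachCell`). [folklore] -/
theorem reachCell2l_iff {e c B : ℤ} {j : ℕ} {ordq m : ℤ} {l : ℕ} (hl : 0 < l) (h : ordq = 2 * l * m) :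
    ReachCell2l e c B j ordq l ↔ ReachCell e c B j m := by
  subst h
  unfold ReachCell2l ReachCell
  have hl' : (0 : ℤ) < 2 * l := by positivity
  constructor
  · rintro ⟨k, h1, h2⟩
    exact ⟨k, by nlinarith, by nlinarith⟩
  · rintro ⟨k, h1, h2⟩
    exact ⟨k, by nlinarith, by nlinarith⟩

/-- **Envelope ⟹ exact cell, with no divisibility assumption on `ord_x(q)`**: from `LinearLaw2l` take the content `k = ⌈X/(2le)⌉`,
`X = j²·ord_x(q) − 2l·(j+1)·(c+e−1)`. Pure integer arithmetic (the `< e` slack of the envelope). [folklore] -/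
theorem reachCell2l_of_linearLaw2l {e c B : ℤ} {j : ℕ} {ordq : ℤ} {l : ℕ} (he : 0 < e) (hl : 0 < l) (h : LinearLaw2l e c B j ordq l) :
    ReachCell2l e c B j ordq l := by
  unfold LinearLaw2l inflation at h
  have hM0 : (0 : ℤ) < 2 * l * e := by positivity
  refine ⟨((j : ℤ) ^ 2 * ordq - 2 * l * (((j : ℤ) + 1) * (c + e - 1)) + 2 * l * e - 1) / (2 * l * e), ?_, ?_⟩
  · have h0 := Int.emod_nonneg ((j : ℤ) ^ 2 * ordq - 2 * l * (((j : ℤ) + 1) * (c + e - 1)) + 2 * l * e - 1) hM0.ne'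
    have h1 := Int.emod_lt_of_pos ((j : ℤ) ^ 2 * ordq - 2 * l * (((j : ℤ) + 1) * (c + e - 1)) + 2 * l * e - 1) hM0
    have h2 := Int.mul_ediv_add_emod ((j : ℤ) ^ 2 * ordq - 2 * l * (((j : ℤ) + 1) * (c + e - 1)) + 2 * l * e - 1) (2 * l * e)
    nlinarith
  · have h0 := Int.emod_nonneg ((j : ℤ) ^ 2 * ordq - 2 * l * (((j : ℤ) + 1) * (c + e - 1)) + 2 * l * e - 1) hM0.ne'
    have h2 := Int.mul_ediv_add_emod ((j : ℤ) ^ 2 * ordq - 2 * l * (((j : ℤ) + 1) * (c + e - 1)) + 2 * l * e - 1) (2 * l * e)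
    nlinarith

/-- Monotonicity of the exact cell in the certificates (a larger inner conductor and a smaller outer order only help; the same content `k` works). [folklore] -/
theorem reachCell2l_mono_cert {e c c' B B' : ℤ} {j : ℕ} {ordq : ℤ} {l : ℕ} (hc : c ≤ c') (hB : B' ≤ B)
    (h : ReachCell2l e c B j ordq l) : ReachCell2l e c' B' j ordq l := by
  obtain ⟨k, h1, h2⟩ := h
  have hj : (0 : ℤ) ≤ 2 * l * ((j : ℤ) + 1) := by positivity
  refine ⟨k, ?_, ?_⟩
  · nlinarith [mul_le_mul_of_nonneg_left hc hj]
  · nlinarith [mul_le_mul_of_nonneg_left hB hj]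

/-- **Where the exact cell and the envelope differ on the table.** HEX:8:5@p7.j2.ev3 (`e_w = 15`, `m_w = 24`, `c = 3`, `B = 7 − 15 = −8`, top label
`j = 2`): the envelope FAILS (`3·24 + 15 = 87 ≤ 3·25 = 75` false) while the exact cell HOLDS with content `k = 3` (`96 ≤ 45 + 51`, `45 − 24 ≤ 24`); and on
the TAME row HEX:3:5@p7.j2.ev1 (`e = 5`, `m = 3`, `c = B = 1`) the exact cell HOLDS with `k = 0` (= the licence cell) where the envelope fails
(`law_hex_3_5_top_neg`). [folklore] -/
theorem reach_not_law_witnesses :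
    (ReachCell 15 3 (-8) 2 24 ∧ ¬ LinearLaw 15 3 (-8) 2 24) ∧ (ReachCell 5 1 1 2 3 ∧ ¬ LinearLaw 5 1 1 2 3) := by
  refine ⟨⟨⟨3, by norm_num, by norm_num⟩, by unfold LinearLaw inflation; decide⟩,
    ⟨⟨0, by norm_num, by norm_num⟩, by unfold LinearLaw inflation; decide⟩⟩

/-! ## §T6.2 The exact cell at a pilot datum and its deciders -/

section ExactCandidate

open Literature.IUT.LogThetaLattice Thm311 Thm311.Real Cor312 Cor312Vol Cor312Prov
  Summit.ABC.IUTFork.Repair.RH.ShellCapacityPlus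

variable {F : Type} [Field F] [NumberField F] (X : PilotData F)

/-- **THE EXACT REACH CELL at a bad place `x | p` and label `j = i+1`** (round-2 input for row 20): for every norm uniformizer `ϖ` of `K_x` and the inner
conductor `c` / outer order `B` of `log_p(𝒪_{K_x}^×)`, the `2l`-cleared exact cell `ReachCell2l e_x c B (i+1) ord_x(q) l` — the author's `ReachCell` («some
integer content `k` of a pure `(j+1)`-tensor of maximal-order primitive vectors fits the Θ-box of depth `j²·m` and its `Ism^{DH}`-reach dominates `t_q`»).
A claim-tagged HYPOTHESIS; asserts nothing. [cite: Mochizuki2012, IUTchIII Thm. 3.11 (i) (Ind2) p. 154] [claim: Mochizuki2012, status: disputed] -/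
@[claim "Mochizuki2012" "disputed"]
def CellReachAt (pp : Nat.Primes) (i : Fin X.lstar) (x : (thetaIndex X).Fibre (.inr pp)) : Prop :=
  haveI : Fact (pp : ℕ).Prime := ⟨pp.2⟩
  ∀ (ϖ : (kOf X pp.1 x)ˣ), IsUniformizer ϖ → ∀ (c : ℕ) (B : ℤ),
    IsInnerConductor (kOf X pp.1 x) ϖ c → IsOuterOrder (kOf X pp.1 x) ϖ B →
      ReachCell2l ((placeOf X pp.1 x).asIdeal.ramificationIdx ℤ : ℤ) (c : ℤ) B ((i : ℕ) + 1)
        (X.ordq (placeOf X pp.1 x)) X.l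

/-- **H⋆₂₀-EXACT «reach cell»**: the exact cell at EVERY bad place and EVERY label of the pilot datum `X` (round-2 slice object of row 20; instantiate
`X := Cor312Prov.pilotDataOfK D K`). A claim-tagged HYPOTHESIS; never asserted. [cite: Mochizuki2012, IUTchIII Thm. 3.11 (i) (Ind2) p. 154]
[claim: Mochizuki2012, status: disputed] -/
@[claim "Mochizuki2012" "disputed"]
def HStarReach : Prop :=
  ∀ (pp : Nat.Primes) (i : Fin X.lstar) (x : (thetaIndex X).Fibre (.inr pp)),
    haveI : Fact (pp : ℕ).Prime := ⟨pp.2⟩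
    placeOf X pp.1 x ∈ X.S → CellReachAt X pp i x

/-- **H⋆₂₀'s (envelope) cell implies the exact cell** (`e_x ≥ 1`, `l ≥ 5`). [folklore] -/
theorem cellReachAt_of_cellAt (pp : Nat.Primes) [Fact (pp : ℕ).Prime] (i : Fin X.lstar) (x : (thetaIndex X).Fibre (.inr pp))
    (h : CellAt X pp i x) : CellReachAt X pp i x := fun ϖ hϖ c B hc hB =>
  reachCell2l_of_linearLaw2l (by exact_mod_cast Ideal.ramificationIdx_pos _ _) (by have := X.five_le_l; omega) (h ϖ hϖ c B hc hB)

/-- `HStar X → HStarReach X` (the envelope candidate implies the exact one). [folklore] -/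
theorem hStarReach_of_hStar (h : HStar X) : HStarReach X := fun pp i x hx => by
  haveI : Fact (pp : ℕ).Prime := ⟨pp.2⟩
  exact cellReachAt_of_cellAt X pp i x (h pp i x hx)

/-- **DECIDER**: once the two lattice integers of `K_x` are certified for ONE uniformizer (`IsInnerConductor c₀`, `IsOuterOrder B₀`), the exact cell IS
`ReachCell2l e_x c₀ B₀ (i+1) ord_x(q) l`. [folklore] -/
theorem cellReachAt_iff_of_certs (pp : Nat.Primes) [Fact (pp : ℕ).Prime] (i : Fin X.lstar) (x : (thetaIndex X).Fibre (.inr pp))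
    {ϖ : (kOf X pp.1 x)ˣ} (hϖ : IsUniformizer ϖ) {c₀ : ℕ} {B₀ : ℤ} (hc : IsInnerConductor (kOf X pp.1 x) ϖ c₀)
    (hB : IsOuterOrder (kOf X pp.1 x) ϖ B₀) :
    CellReachAt X pp i x ↔
      ReachCell2l ((placeOf X pp.1 x).asIdeal.ramificationIdx ℤ : ℤ) (c₀ : ℤ) B₀ ((i : ℕ) + 1) (X.ordq (placeOf X pp.1 x)) X.l := by
  constructor
  · intro h; exact h ϖ hϖ c₀ B₀ hc hB
  · intro h ϖ' hϖ' c B hc' hB'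
    have hn : ‖((ϖ' : (kOf X pp.1 x)ˣ) : kOf X pp.1 x)‖ = ‖((ϖ : (kOf X pp.1 x)ˣ) : kOf X pp.1 x)‖ :=
      norm_eq_norm_of_isUniformizer (kOf X pp.1 x) hϖ' hϖ
    rw [isInnerConductor_congr hn] at hc'
    rw [isOuterOrder_congr hn] at hB'
    rw [isInnerConductor_unique hc' hc, isOuterOrder_unique hϖ hB' hB]
    exact h

/-- **FAITHFULNESS**: at `ord_x(q) = 2l·m` (realising data) the exact cell IS the author's `HReachCell p K_x ϖ (i+1) m` for every norm uniformizer
(`e(K_x/ℚ_p) = e(x|p)`, `RH.ShellCapacityPlus.absRamificationIdx_kOf`). [cite: Mochizuki2012, IUTchI Ex. 3.2 (iv) p. 71] [claim: Mochizuki2012, status: disputed] -/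
theorem cellReachAt_iff_forall_hReachCell (pp : Nat.Primes) [Fact (pp : ℕ).Prime] (i : Fin X.lstar)
    (x : (thetaIndex X).Fibre (.inr pp)) {m : ℤ} (hm : X.ordq (placeOf X pp.1 x) = 2 * X.l * m) :
    CellReachAt X pp i x ↔
      ∀ ϖ : (kOf X pp.1 x)ˣ, IsUniformizer ϖ → HReachCell pp (kOf X pp.1 x) ϖ ((i : ℕ) + 1) m := by
  have hl : 0 < X.l := by have := X.five_le_l; omega
  unfold CellReachAt HReachCell
  refine forall_congr' fun ϖ => forall_congr' fun _ => forall_congr' fun c => forall_congr' fun B =>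
    forall_congr' fun _ => forall_congr' fun _ => ?_
  rw [absRamificationIdx_kOf X pp x, reachCell2l_iff hl hm]

/-- **COLUMN-NEG ⇒ NEG of the exact cell, unconditionally** (every `p`, `e_x`; tie rows included): if `ReachCell2l` fails at the column values
`c := ⌊e_x/(p−1)⌋ + 1 = r_in_ub`, `B := p^{a₀} − e_x·a₀ = r_out_sharp` (`a₀` any turning point), the exact cell fails at `x`.
[cite: NeukirchANT1999, Ch. II (5.5)] [claim: Mochizuki2012, status: disputed] -/
theorem not_cellReachAt_of_not_col (pp : Nat.Primes) [Fact (pp : ℕ).Prime] (i : Fin X.lstar) (x : (thetaIndex X).Fibre (.inr pp)) {a₀ : ℕ}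
    (hlo : ∀ a < a₀, ((pp : ℕ) : ℤ) ^ a * (((pp : ℕ) : ℤ) - 1) < (placeOf X pp.1 x).asIdeal.ramificationIdx ℤ)
    (hhi : ((placeOf X pp.1 x).asIdeal.ramificationIdx ℤ : ℤ) ≤ ((pp : ℕ) : ℤ) ^ a₀ * (((pp : ℕ) : ℤ) - 1))
    (hneg : ¬ ReachCell2l ((placeOf X pp.1 x).asIdeal.ramificationIdx ℤ : ℤ)
      (((placeOf X pp.1 x).asIdeal.ramificationIdx ℤ / ((pp : ℕ) - 1) + 1 : ℕ) : ℤ)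
      (((pp : ℕ) : ℤ) ^ a₀ - ((placeOf X pp.1 x).asIdeal.ramificationIdx ℤ : ℤ) * (a₀ : ℤ)) ((i : ℕ) + 1)
      (X.ordq (placeOf X pp.1 x)) X.l) :
    ¬ CellReachAt X pp i x := by
  intro h
  have he : absRamificationIdx pp (kOf X pp.1 x) = (placeOf X pp.1 x).asIdeal.ramificationIdx ℤ := absRamificationIdx_kOf X pp x
  have hϖ := isUniformizer_unifChoice (kOf X pp.1 x)
  obtain ⟨c, hc⟩ := exists_isInnerConductor (pp : ℕ) hϖ
  obtain ⟨B, hB⟩ := exists_isOuterOrder (pp : ℕ) hϖ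
  have hcle := isInnerConductor_le (pp : ℕ) hϖ hc
  rw [← he] at hlo hhi
  have hBge := le_of_isOuterOrder (pp : ℕ) hϖ hB hlo hhi
  rw [he] at hcle hBge
  exact hneg (reachCell2l_mono_cert (by exact_mod_cast hcle) hBge (h _ hϖ c B hc hB))

/-- **COLUMN CELL ⟺ EXACT CELL when `(p−1) ∤ e_x`** (strict turning point `a₀`): the column evaluation at `(r_in_ub, r_out_sharp)` DECIDES the exact cell at
every field of that type. [cite: NeukirchANT1999, Ch. II (5.5)] [claim: Mochizuki2012, status: disputed] -/
theorem cellReachAt_iff_col_of_not_dvd (pp : Nat.Primes) [Fact (pp : ℕ).Prime] (i : Fin X.lstar) (x : (thetaIndex X).Fibre (.inr pp))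
    (hnd : ¬ ((pp : ℕ) - 1 ∣ (placeOf X pp.1 x).asIdeal.ramificationIdx ℤ)) {a₀ : ℕ}
    (hlo : ∀ a < a₀, ((pp : ℕ) : ℤ) ^ a * (((pp : ℕ) : ℤ) - 1) < (placeOf X pp.1 x).asIdeal.ramificationIdx ℤ)
    (hhi : ((placeOf X pp.1 x).asIdeal.ramificationIdx ℤ : ℤ) < ((pp : ℕ) : ℤ) ^ a₀ * (((pp : ℕ) : ℤ) - 1)) :
    CellReachAt X pp i x ↔
      ReachCell2l ((placeOf X pp.1 x).asIdeal.ramificationIdx ℤ : ℤ)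
        (((placeOf X pp.1 x).asIdeal.ramificationIdx ℤ / ((pp : ℕ) - 1) + 1 : ℕ) : ℤ)
        (((pp : ℕ) : ℤ) ^ a₀ - ((placeOf X pp.1 x).asIdeal.ramificationIdx ℤ : ℤ) * (a₀ : ℤ)) ((i : ℕ) + 1)
        (X.ordq (placeOf X pp.1 x)) X.l := by
  have he : absRamificationIdx pp (kOf X pp.1 x) = (placeOf X pp.1 x).asIdeal.ramificationIdx ℤ := absRamificationIdx_kOf X pp x
  have hϖ := isUniformizer_unifChoice (kOf X pp.1 x)
  rw [← he] at hnd hlo hhi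
  have hc := isInnerConductor_of_not_dvd (pp : ℕ) hϖ hnd
  have hB := isOuterOrder_envelope (pp : ℕ) hϖ hlo hhi
  rw [he] at hc hB
  exact cellReachAt_iff_of_certs X pp i x hϖ hc hB

/-- A failed exact cell at a bad place refutes `HStarReach` at the datum. [folklore] -/
theorem not_hStarReach_of_not_cellReachAt (pp : Nat.Primes) [Fact (pp : ℕ).Prime] (i : Fin X.lstar) (x : (thetaIndex X).Fibre (.inr pp))
    (hx : placeOf X pp.1 x ∈ X.S) (hneg : ¬ CellReachAt X pp i x) : ¬ HStarReach X := fun h => hneg (h pp i x hx)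

end ExactCandidate

end Summit.ABC.IUTFork.Repair.RH.LinearReachLaw

end
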